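import Summits.BirchSwinnertonDyer.BirchSwinnertonDyer.Theorems.ThetaPartnerAtTwoSignedControlAtTwoRelaxedKummerCountMultiPlace
import HarnessLib

/-!
# The relative Poitou–Tate count between two RELAXED Kummer structures, with its dual index:
# `#(H¹_{⊤ on T∪V}/H¹_{⊤ on T}) · #(Sel^{str T}/Sel^{str T∪V}) = ∏_{w∈V} #𝓛_w`
# (crux ♭T≤ stmt-BirchSwinnertonDyer-23042, line `sigmacongruence`, stub R1 `stub_relaxedImageCount`, brick (a) of the relaxed count road)

Route `UniversalToricDescent`, lead prover `bsd-wall-utd-p1` g18. THEOREMS ONLY (no definition, no named fact, no `sorry`);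
`--supports stmt-BirchSwinnertonDyer-23042`. BSD is not proved by any of this.

For an elliptic curve `E = W` over a number field `K` ALL OF WHOSE INFINITE PLACES ARE COMPLEX, a prime `p`, `k ≥ 1`, and two disjoint
finite sets `T`, `V` of finite places, consider on `E[p^k]` the Kummer Selmer structures relaxed (`⊤`) on `T ∪ ∞` resp. on `T ∪ V ∪ ∞`
(`kummerRelaxed`, X11b `KummerRelaxedStructures`): `𝓕 ≤ 𝓖`. Howard's Thm. 2.1.11 in counting form (tree
`natCard_selmerQuotient_mul_of_poitouTate`, from the named Poitou–Tate fact `poitouTate_selmerStructure_duality K`) gives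
`#(H¹_𝓖/H¹_𝓕) · #(H¹_{𝓕*}/H¹_{𝓖*}) · ∏ #𝓕_v = ∏ #𝓖_v`, the products differing only on `V` where `#𝓖_w = #H¹(K_w, E[p^k]) = #𝓛_w²`
(Tate) and `#𝓕_w = #𝓛_w` (`𝓛_w` the local Kummer condition, `#𝓛_w = #E(K_w)[p^k] · #(𝓞_w/p^k)`):

* §1 `natCard_quotient_mul_natCard_dualQuotient_eq` — **`#(H¹_𝓖/H¹_𝓕) · #(H¹_{𝓕*}/H¹_{𝓖*}) = ∏_{w∈V} #𝓛_w`** for a Poitou–Tate family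
  `inv` (the MultiPlace file keeps only the inequality `∏ #𝓛 ≤ #H¹_𝓖`; here the dual index is kept EXACTLY).
* §2 `natCard_quotient_eq_of_bijective` — generic: a bijection of subgroups matching two smaller subgroups gives equal indices.
The Weil identification of the dual index with the STRICT-quotient `#(H¹_{str T∪∞}/H¹_{str T∪V∪∞})` and the assembled identity from the
named fact are the sequel `…RelaxedKummerPairCountStrict`.

On the route (`K_n` a layer of the anticyclotomic tower, `T` = places over `3` and over `S`, `V` = places over `v`): the first factor counts the
image of the relaxed-above-`3` classes in the local groups at `V` (the `v`-signature after transport to `Y^{S∪v}`), the second is the DUAL TERM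
`D′_n`, a quotient of the `3`-STRICT Selmer group — strict at both primes above `3`, the point of the relaxed count road (memo
`Cruxes/DefectTransportModThreePT/Lines/sigmacongruence-relaxed-count-road.md` §2(a),(d)).

References: [MilneADT2006] I Thm. 4.10, Lemma 3.3, Cor. 2.3, Cor. 3.4; [Howard2004HeegnerKolyvagin] Def. 2.1.6, 2.1.10, Thm. 2.1.11;
[GreenbergVatsal2000] §2 Prop. (2.1); [PoonenRains2012] Prop. 4.10.
-/

set_option linter.dupNamespace false
set_option autoImplicit false

noncomputable section
open scoped Classical
open CategoryTheory Field NumberField IsDedekindDomain Function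
open Literature.NumberTheory.EllipticCurves Literature.NumberTheory.EllipticCurves.GreenbergSelmer
open Literature.NumberTheory.GaloisRepresentations
open Literature.NumberTheory.GaloisRepresentations.DiscreteGaloisModule (SelmerStructure tateDual)
open Literature.NumberTheory.GaloisCohomology
open scoped ContRepresentation

namespace Summit.BirchSwinnertonDyer.BirchSwinnertonDyer.Theorems.UniversalToricDescentRelaxedKummerPairCount

open Summit.BirchSwinnertonDyer.Rank1Residual.X11b.KummerPT Summit.BirchSwinnertonDyer.Rank1Residual.X11b.LocBridge
  Summit.BirchSwinnertonDyer.Rank1Residual.X11b.Levels Summit.BirchSwinnertonDyer.Rank1Residual.X11b.AcSelmer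
  Summit.BirchSwinnertonDyer.Rank1Residual.X11b.Relaxation Summit.BirchSwinnertonDyer.Rank1Residual.X11b.SelmerLevelBound
  Summit.BirchSwinnertonDyer.BirchSwinnertonDyer.Theorems.SignedEC.RelaxedKummerCount

variable {K : Type} [Field K] [NumberField K] (W : WeierstrassCurve K) [W.IsElliptic] (p k : ℕ)
  [Fact p.Prime]

/-! ## §1 The pair count with its dual index -/

/-- **`#(H¹_𝓖/H¹_𝓕) · #(H¹_{𝓕*}/H¹_{𝓖*}) = ∏_{w∈V} #𝓛_w`** for `𝓕 = kummerRelaxed (T ∪ ∞) ≤ 𝓖 = kummerRelaxed (T ∪ V ∪ ∞)` on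
`E[p^k]`, `T, V` disjoint finite sets of finite places, GIVEN a Poitou–Tate family `inv` (`IsPerfect`, `SumLocalTermEqZero`,
`SelmerComplement`): Milne I 4.10 in counting form, `#𝓖_w = #𝓛_w²` (Tate) and `#𝓕_w = #𝓛_w` at `w ∈ V`.
[cite: MilneADT2006, Ch. I, Thm. 4.10, Thm. 2.8, Lemma 3.3] [cite: Howard2004HeegnerKolyvagin, Thm. 2.1.11 (arXiv:1202.6340 p. 6)] -/
theorem natCard_quotient_mul_natCard_dualQuotient_eq [Finite (W.geomTorsion ((p ^ k : ℕ) : ℤ))] (hk : 0 < k)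
    {inv : LocalInvariants K (p ^ k)}
    (hperf : inv.IsPerfect) (hsum : inv.SumLocalTermEqZero) (hcompl : inv.SelmerComplement)
    (T V : Finset (HeightOneSpectrum (𝓞 K))) (hTV : Disjoint T V) :
    Nat.card ((kummerRelaxed W (p ^ k) ((T.image Sum.inr ∪ Finset.univ.image Sum.inl) ∪ V.image Sum.inr)).selmerGroup ⧸
        ((kummerRelaxed W (p ^ k) (T.image Sum.inr ∪ Finset.univ.image Sum.inl)).selmerGroup).addSubgroupOf
          (kummerRelaxed W (p ^ k) ((T.image Sum.inr ∪ Finset.univ.image Sum.inl) ∪ V.image Sum.inr)).selmerGroup) *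
      Nat.card ((inv.dualSelmerStructure (W.torsionGaloisModule ((p ^ k : ℕ) : ℤ))
          (kummerRelaxed W (p ^ k) (T.image Sum.inr ∪ Finset.univ.image Sum.inl))).selmerGroup ⧸
        ((inv.dualSelmerStructure (W.torsionGaloisModule ((p ^ k : ℕ) : ℤ))
          (kummerRelaxed W (p ^ k) ((T.image Sum.inr ∪ Finset.univ.image Sum.inl) ∪ V.image Sum.inr))).selmerGroup).addSubgroupOf
          (inv.dualSelmerStructure (W.torsionGaloisModule ((p ^ k : ℕ) : ℤ))
            (kummerRelaxed W (p ^ k) (T.image Sum.inr ∪ Finset.univ.image Sum.inl))).selmerGroup) =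
      ∏ w ∈ V, Nat.card (W.kummerSelmerStructure ((p ^ k : ℕ) : ℤ) (Sum.inr w)) := by
  classical
  have hprime : p.Prime := Fact.out
  haveI : NeZero (p ^ k) := ⟨pow_ne_zero k hprime.ne_zero⟩
  haveI : CompactSpace (absoluteGaloisGroup K) := absoluteGaloisGroup_compactSpace K
  have hpp : IsPrimePow (p ^ k) := ⟨p, k, hprime.prime, hk, rfl⟩
  have hEuler : ∀ v : HeightOneSpectrum (𝓞 K),
      Nat.card (galoisCohomology ((W.torsionGaloisModule ((p ^ k : ℕ) : ℤ)).toLocal (Sum.inr v)) 1) =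
        (Nat.card (nsmulAddMonoidHom (p ^ k) :
            (W.baseChange (v.adicCompletion K)).toAffine.Point →+ _).ker *
          Nat.card (v.adicCompletionIntegers K ⧸
            Ideal.span {((p ^ k : ℕ) : v.adicCompletionIntegers K)})) ^ 2 := fun v ↦
    natCard_galoisCohomology_one_torsion_adicCompletion_eq_sqEP W v (p ^ k) hpp
  -- the two relaxed structures
  set R : Finset (Place K) := Finset.univ.image Sum.inl with hR
  set ST : Finset (Place K) := T.image Sum.inr ∪ R with hST
  set SG : Finset (Place K) := ST ∪ V.image Sum.inr with hSG
  set ρ := W.torsionGaloisModule ((p ^ k : ℕ) : ℤ) with hρ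
  set 𝓕 : SelmerStructure ρ := kummerRelaxed W (p ^ k) ST with h𝓕def
  set 𝓖 : SelmerStructure ρ := kummerRelaxed W (p ^ k) SG with h𝓖def
  have hSTSG : ST ⊆ SG := Finset.subset_union_left
  have hle : 𝓕 ≤ 𝓖 := by
    intro v
    by_cases hv : v ∈ ST
    · rw [h𝓕def, h𝓖def, kummerRelaxed_of_mem W (p ^ k) ST hv, kummerRelaxed_of_mem W (p ^ k) SG (hSTSG hv)]
    · rw [h𝓕def, kummerRelaxed_of_not_mem W (p ^ k) ST hv]
      by_cases hv' : v ∈ SG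
      · rw [h𝓖def, kummerRelaxed_of_mem W (p ^ k) SG hv']; exact le_top
      · rw [h𝓖def, kummerRelaxed_of_not_mem W (p ^ k) SG hv']
  -- exceptional set
  obtain ⟨Tx, hSGT, hinf, hp, hbad⟩ := exists_exceptional_finset W p SG
  have hMn : ∀ m : W.geomTorsion ((p ^ k : ℕ) : ℤ), (p ^ k) • m = 0 := fun m ↦
    AddSubgroup.torsionBy.nsmul m
  have hTout : ∀ v : HeightOneSpectrum (𝓞 K), (Sum.inr v : Place K) ∉ Tx →
      ((p ^ k : ℕ) : 𝓞 K) ∉ v.asIdeal ∧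
        GaloisRep.IsUnramifiedAt v (W.torsionGaloisModule ((p ^ k : ℕ) : ℤ)) := by
    intro v hv
    have hpv : ((p : ℕ) : 𝓞 K) ∉ v.asIdeal := fun h ↦ hv (hp v h)
    have hgood : W.HasGoodReductionAt v := by
      by_contra hbad'
      exact hv (hbad v hbad')
    exact ⟨natCast_pow_not_mem p hpv _,
      isUnramifiedAt_torsionGaloisModule W hgood (intCast_pow_not_mem p hpv _)⟩
  have h𝓕 : 𝓕.IsUnramifiedOutside Tx :=
    kummerRelaxed_isUnramifiedOutside W p k ST Tx (hSTSG.trans hSGT) hinf hp hbad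
  have h𝓖 : 𝓖.IsUnramifiedOutside Tx :=
    kummerRelaxed_isUnramifiedOutside W p k SG Tx hSGT hinf hp hbad
  have hinlST : ∀ w : InfinitePlace K, (Sum.inl w : Place K) ∈ ST := fun w ↦
    Finset.mem_union_right _ (inl_mem_image_inl w)
  have hinfeq : ∀ w : InfinitePlace K, 𝓕 (Sum.inl w) = 𝓖 (Sum.inl w) := fun w ↦ by
    rw [h𝓕def, h𝓖def, kummerRelaxed_of_mem W (p ^ k) ST (hinlST w),
      kummerRelaxed_of_mem W (p ^ k) SG (hSTSG (hinlST w))]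
  set Sf : Finset (HeightOneSpectrum (𝓞 K)) := Tx.preimage Sum.inr (Sum.inr_injective.injOn) with hSf
  have hSfmem : ∀ v, v ∈ Sf ↔ (Sum.inr v : Place K) ∈ Tx := fun v ↦ by
    rw [hSf, Finset.mem_preimage]
  -- Poitou–Tate, counting form
  have key := natCard_selmerQuotient_mul_of_poitouTate hperf hsum hcompl ρ hMn Tx hTout hle h𝓕 h𝓖 hinfeq Sf
    hSfmem
  -- abbreviations
  set L : HeightOneSpectrum (𝓞 K) → ℕ := fun 𝔮 ↦
    Nat.card (W.kummerSelmerStructure ((p ^ k : ℕ) : ℤ) (Sum.inr 𝔮)) with hL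
  have hVSG : ∀ 𝔮 ∈ V, (Sum.inr 𝔮 : Place K) ∈ SG := fun 𝔮 h𝔮 ↦
    Finset.mem_union_right _ ((inr_mem_image_inr_iff V 𝔮).mpr h𝔮)
  have hVST : ∀ 𝔮 ∈ V, (Sum.inr 𝔮 : Place K) ∉ ST := fun 𝔮 h𝔮 h ↦ by
    have hT : 𝔮 ∈ T := (inr_mem_image_inr_union_iff T 𝔮).mp h
    exact Finset.disjoint_left.mp hTV hT h𝔮
  have hVSf : V ⊆ Sf := fun 𝔮 h𝔮 ↦ (hSfmem 𝔮).mpr (hSGT (hVSG 𝔮 h𝔮))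
  have h𝓕V : ∀ 𝔮 ∈ V, Nat.card (𝓕 (Sum.inr 𝔮)) = L 𝔮 := fun 𝔮 h𝔮 ↦ by
    rw [h𝓕def, kummerRelaxed_of_not_mem W (p ^ k) ST (hVST 𝔮 h𝔮)]
  have h𝓖V : ∀ 𝔮 ∈ V, 𝓖 (Sum.inr 𝔮) = ⊤ := fun 𝔮 h𝔮 ↦ by
    rw [h𝓖def, kummerRelaxed_of_mem W (p ^ k) SG (hVSG 𝔮 h𝔮)]
  have hoff : ∀ v ∈ Sf \ V, 𝓕 (Sum.inr v) = 𝓖 (Sum.inr v) := by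
    intro v hv
    have hvV : v ∉ V := (Finset.mem_sdiff.mp hv).2
    by_cases hvST : (Sum.inr v : Place K) ∈ ST
    · rw [h𝓕def, h𝓖def, kummerRelaxed_of_mem W (p ^ k) ST hvST, kummerRelaxed_of_mem W (p ^ k) SG (hSTSG hvST)]
    · have hvSG : (Sum.inr v : Place K) ∉ SG := fun h ↦ by
        rcases Finset.mem_union.mp h with h | h
        · exact hvST h
        · exact hvV ((inr_mem_image_inr_iff V v).mp h)
      rw [h𝓕def, h𝓖def, kummerRelaxed_of_not_mem W (p ^ k) ST hvST, kummerRelaxed_of_not_mem W (p ^ k) SG hvSG]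
  -- local finiteness and the local count on `V`
  haveI hfinloc : ∀ v : HeightOneSpectrum (𝓞 K),
      Finite (galoisCohomology (ρ.toLocal (Sum.inr v)) 1) := fun v ↦
    finite_galoisCohomology_toLocal_inr W (p ^ k) v
  have hLcard : ∀ 𝔮, L 𝔮 = Nat.card (nsmulAddMonoidHom (p ^ k) :
        (W.baseChange (𝔮.adicCompletion K)).toAffine.Point →+ _).ker *
      Nat.card (𝔮.adicCompletionIntegers K ⧸ Ideal.span {((p ^ k : ℕ) : 𝔮.adicCompletionIntegers K)}) :=
    fun 𝔮 ↦ W.natCard_kummerSelmerStructure_inr 𝔮 (NeZero.ne (p ^ k))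
  have htop : ∀ 𝔮 ∈ V, Nat.card (𝓖 (Sum.inr 𝔮)) = L 𝔮 * L 𝔮 := fun 𝔮 h𝔮 ↦ by
    rw [h𝓖V 𝔮 h𝔮, AddSubgroup.card_top, hEuler 𝔮, hLcard, sq]
  have hLpos : ∀ 𝔮, 0 < L 𝔮 := fun 𝔮 ↦ Nat.card_pos
  have hprodLpos : 0 < ∏ 𝔮 ∈ V, L 𝔮 := Finset.prod_pos fun 𝔮 _ ↦ hLpos 𝔮
  -- split the products along `V ⊆ Sf`
  set P := ∏ v ∈ Sf \ V, Nat.card (𝓕 (Sum.inr v)) with hP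
  have hPpos : 0 < P := Finset.prod_pos fun v _ ↦ Nat.card_pos
  have hprodF : ∏ v ∈ Sf, Nat.card (𝓕 (Sum.inr v)) = P * ∏ 𝔮 ∈ V, L 𝔮 := by
    rw [← Finset.prod_sdiff hVSf, Finset.prod_congr rfl h𝓕V]
  have hPeq : ∏ v ∈ Sf \ V, Nat.card (𝓖 (Sum.inr v)) = P :=
    Finset.prod_congr rfl fun v hv ↦ by rw [hoff v hv]
  have hprodG : ∏ v ∈ Sf, Nat.card (𝓖 (Sum.inr v)) = P * ((∏ 𝔮 ∈ V, L 𝔮) * ∏ 𝔮 ∈ V, L 𝔮) := by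
    rw [← Finset.prod_sdiff hVSf, hPeq, Finset.prod_congr rfl htop, Finset.prod_mul_distrib]
  -- the two indices
  set a := Nat.card (𝓖.selmerGroup ⧸ (𝓕.selmerGroup).addSubgroupOf 𝓖.selmerGroup) with ha
  set b := Nat.card ((inv.dualSelmerStructure ρ 𝓕).selmerGroup ⧸
    ((inv.dualSelmerStructure ρ 𝓖).selmerGroup).addSubgroupOf (inv.dualSelmerStructure ρ 𝓕).selmerGroup) with hb
  rw [hprodF, hprodG] at key
  have key' : a * b * (P * ∏ 𝔮 ∈ V, L 𝔮) = (∏ 𝔮 ∈ V, L 𝔮) * (P * ∏ 𝔮 ∈ V, L 𝔮) := by rw [key]; ring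
  exact Nat.eq_of_mul_eq_mul_right (Nat.mul_pos hPpos hprodLpos) key'

/-! ## §2 Generic index bookkeeping -/

/-- Generic counting: a bijection `Ψ : B → B'` of additive groups' underlying subgroups carrying `C ≤ B` onto `C' ≤ B'`
(as sets: `x ∈ C' ↔ Ψ⁻¹ x ∈ C`) gives `#(B/C) = #(B'/C')`. Stated for subgroups of two ambient groups with the compatibility
`Ψ y ∈ C' ↔ y ∈ C`. [folklore] -/
theorem natCard_quotient_eq_of_bijective {X X' : Type*} [AddCommGroup X] [AddCommGroup X'] {B C : AddSubgroup X}
    {B' C' : AddSubgroup X'} (hCB : C ≤ B) (hC'B' : C' ≤ B') [Finite B] (Ψ : B → B') (hΨ : Function.Bijective Ψ)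
    (hmem : ∀ y : B, ((Ψ y : B') : X') ∈ C' ↔ ((y : B) : X) ∈ C) :
    Nat.card (B ⧸ C.addSubgroupOf B) = Nat.card (B' ⧸ C'.addSubgroupOf B') := by
  haveI : Finite B' := Finite.of_surjective Ψ hΨ.2
  haveI : Finite C := Finite.of_injective (fun c : C ↦ (⟨(c : X), hCB c.2⟩ : B))
    fun a b h ↦ Subtype.ext (congrArg (fun z : B ↦ (z : X)) h)
  have hB : Nat.card B = Nat.card (B ⧸ C.addSubgroupOf B) * Nat.card C := by
    rw [AddSubgroup.card_eq_card_quotient_mul_card_addSubgroup (C.addSubgroupOf B),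
      Nat.card_congr (AddSubgroup.addSubgroupOfEquivOfLe hCB).toEquiv]
  have hB' : Nat.card B' = Nat.card (B' ⧸ C'.addSubgroupOf B') * Nat.card C' := by
    rw [AddSubgroup.card_eq_card_quotient_mul_card_addSubgroup (C'.addSubgroupOf B'),
      Nat.card_congr (AddSubgroup.addSubgroupOfEquivOfLe hC'B').toEquiv]
  have hBB' : Nat.card B = Nat.card B' := Nat.card_eq_of_bijective Ψ hΨ
  -- `Ψ` restricts to a bijection `C ≃ C'`
  let ΨC : C → C' := fun c ↦ ⟨((Ψ ⟨c, hCB c.2⟩ : B') : X'), (hmem ⟨c, hCB c.2⟩).mpr c.2⟩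
  have hΨCval : ∀ c : C, ((ΨC c : C') : X') = ((Ψ ⟨c, hCB c.2⟩ : B') : X') := fun _ ↦ rfl
  have hΨC : Function.Bijective ΨC := by
    constructor
    · intro c c' h
      have h1 : ((Ψ ⟨c, hCB c.2⟩ : B') : X') = ((Ψ ⟨c', hCB c'.2⟩ : B') : X') := by
        rw [← hΨCval, ← hΨCval, h]
      have h2 : (⟨(c : X), hCB c.2⟩ : B) = ⟨(c' : X), hCB c'.2⟩ := hΨ.1 (Subtype.ext h1)
      exact Subtype.ext (congrArg (fun z : B ↦ (z : X)) h2)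
    · intro c'
      obtain ⟨y, hy⟩ := hΨ.2 ⟨c', hC'B' c'.2⟩
      have hyC : ((y : B) : X) ∈ C := (hmem y).mp (by rw [hy]; exact c'.2)
      refine ⟨⟨y, hyC⟩, Subtype.ext ?_⟩
      rw [hΨCval]
      have e1 : (⟨((⟨(y : X), hyC⟩ : C) : X), hCB hyC⟩ : B) = y := Subtype.ext rfl
      rw [e1, hy]
  haveI : Finite C' := Finite.of_surjective ΨC hΨC.2
  have hCC' : Nat.card C = Nat.card C' := Nat.card_eq_of_bijective ΨC hΨC
  have hCpos : 0 < Nat.card C' := Nat.card_pos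
  rw [hBB', hB', hCC'] at hB
  exact (Nat.eq_of_mul_eq_mul_right hCpos hB).symm

end Summit.BirchSwinnertonDyer.BirchSwinnertonDyer.Theorems.UniversalToricDescentRelaxedKummerPairCount

end
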